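import Summits.CriticalPhenomena.Ising3DConformalLimit.Theorems.EnergyNotSigmaSquaredMoebiusLimitExistsOneMapOneJetDefs
import Summits.CriticalPhenomena.Ising3DConformalLimit.Theorems.GaussianScaleMixtureRotationUpgradeFromTwoPointAnalyticOffFinite
import Summits.CriticalPhenomena.Ising3DConformalLimit.Theorems.GaussianScaleMixtureRotationUpgradeFromTwoPointNineMirrorRP
import Literature.MathematicalPhysics.QuantumFieldTheory.MirrorDirectionalAnalyticity
import Literature.Analysis.Complex.CrossTheoremNStrips
import HarnessLib

/-!
# Crux `MoebiusLimitExists` (stmt-CriticalPhenomena-1344), line `one-map-one-jet`: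
# STUB 2 `stub_nineMirrorAnalyticity` — joint real-analyticity of the scaling limit on the good configurations

Statement (registered stub of the checked skeleton `Cruxes/MoebiusLimitExists/Lines/one-map-one-jet.lean`,
proved by name below, verbatim signature, namespace of the line's Defs file).  For every normalised,
non-degenerate, translation-invariant, scale-covariant (`0 < Δ`) pointwise scaling limit `S` of the
critical `ℤ³` Ising correlators `criticalCorr 3` (`ρ > 0` on `(0,1]`) which is continuous off the
diagonals, every `S n` is jointly real-analytic (`AnalyticOnNhd ℝ`) on `GoodConfig n`: the
non-coincident configurations `x` admitting three linearly independent lattice mirror normals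
`v₀, v₁, v₂ ∈ mirrorNormals = {eᵢ, eᵢ ± eⱼ}` along each of which the heights `i ↦ ⟪x i, v_a⟫` are
pairwise distinct.

## Proof (all inputs in the tree)

* STRUCTURE OF THE LIMIT.  `QuarterTurnLiouville.stub_limitRegularity` (permutation symmetry E3, …),
  `NullLaplacianEdgeGaussianity.stub_nineMirrorRP` (Osterwalder–Schrader positivity of all orders in
  the nine lattice mirrors: site-mirror reflection positivity OF `criticalCorr 3`,
  Fröhlich–Israel–Lieb–Simon 1978 §3, passed to the limit — this is where the lattice clause is used),
  `QuarterTurnLiouville.stub_inPlaneLightCone` (with `Literature.Analysis.Complex.DiamondCross_holds`)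
  and `NullLaplacianEdgeGaussianity.halfPlaneHolomorphy_of_inPlaneLightCone`: for every lattice normal
  `v` the two-cluster functions of the mirror `v^⊥` are holomorphic in the normal translation of the
  second cluster on `{Re t > 0}` with the Gram bound (Glimm–Jaffe Thm 6.1.3).
* DIRECTIONAL ANALYTICITY, LOCALLY UNIFORMLY
  (`Literature.MathematicalPhysics.QuantumFieldTheory.eventually_exists_disc_extension_pointShift`: the
  one-mirror lemma in two slab directions + Bernstein's cross theorem): if the height `⟪x i, v⟫` differs
  from all other heights, `t ↦ S n (z with z i := z i + t v)` is on a fixed interval the trace of a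
  function holomorphic on a fixed disc with a fixed bound, for all `z` near `x`.  At `x ∈ GoodConfig n`
  this applies to all `3n` pairs `(i, a)`.
* THE LOCAL `3n`-FOLD CROSS THEOREM
  (`Literature.Analysis.Complex.exists_holomorphic_extension_of_separately_local_fintype`, Bernstein 1912 /
  Siciak 1969 / Jarnicki–Pflug 2011 Ch. 5, landed for this stub together with the `N`-fold strip
  theorem it rests on) and the chart lemma
  `Literature.Analysis.Complex.analyticAt_of_holomorphic_chart_fintype`: the `3n` directions "move point
  `i` along `v_a`" form the basis `(i, a) ↦ Pi.single i (v a)` of `(ℝ³)ⁿ` (the `v_a` are linearly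
  independent), and the function `t ↦ S n ((x j + Σ_a t (j, a) • v a)_j)` on a small cube has exactly
  the slice data of the local cross theorem (`cfg_update`), so `S n` is real-analytic at `x`.
  Order `n = 0` is a function on a one-point space.

The stub does not use `0 < Δ`.  No definitions are introduced.

## References

* J. Glimm, A. Jaffe, *Quantum Physics* (2nd ed. 1987), §6.1 Thm 6.1.3. [GlimmJaffe1987]
* K. Osterwalder, R. Schrader, Comm. Math. Phys. 31 (1973) 83–112; 42 (1975) 281–305, §4.
* J. Fröhlich, R. Israel, E. H. Lieb, B. Simon, Comm. Math. Phys. 62 (1978) 1–34, §3 Thm 3.1. [FrohlichEtAl1978]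
* M. Jarnicki, P. Pflug, *Separately Analytic Functions*, EMS Tracts in Mathematics 16 (2011), Ch. 5. [JarnickiPflug2011]
-/

noncomputable section

open scoped InnerProductSpace Topology BigOperators
open Set Function Filter Metric EuclideanGeometry
open Literature.Probability.LatticeModels
open Literature.MathematicalPhysics.QuantumFieldTheory
open Literature.Analysis.Complex
open Summit.CriticalPhenomena.Ising3DConformalLimit.Cruxes.LimitRotationInvariant
open Summit.CriticalPhenomena.Ising3DConformalLimit.Cruxes.RotationUpgradeFromTwoPoint

namespace Summit.CriticalPhenomena.Ising3DConformalLimit.MoebiusLimitExistsOneMapOneJet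

/-- Moving one coordinate `(i, a)` of the parameter `y` moves the point `i` of the configuration
`j ↦ x j + Σ_a y (j, a) • v a` along the frame vector `v a`. [folklore] -/
theorem cfg_update {n : ℕ} (x : Fin n → EuclideanSpace ℝ (Fin 3))
    (v : Fin 3 → EuclideanSpace ℝ (Fin 3)) (y : Fin n × Fin 3 → ℝ) (i : Fin n) (a : Fin 3) (s : ℝ) :
    (fun j => x j + ∑ a', Function.update y (i, a) s (j, a') • v a') =
      Function.update (fun j => x j + ∑ a', y (j, a') • v a') i
        ((x i + ∑ a', y (i, a') • v a') + (s - y (i, a)) • v a) := by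
  funext j
  by_cases hj : j = i
  · subst hj
    rw [Function.update_self]
    have h : ∀ a', Function.update y (j, a) s (j, a') • v a' =
        y (j, a') • v a' + (if a' = a then (s - y (j, a)) • v a else 0) := by
      intro a'
      by_cases ha : a' = a
      · subst ha
        rw [Function.update_self, if_pos rfl, ← add_smul]
        congr 1
        ring
      · rw [Function.update_of_ne (fun h => ha (Prod.mk.inj h).2), if_neg ha, add_zero]
    rw [Finset.sum_congr rfl fun a' _ => h a', Finset.sum_add_distrib, Finset.sum_ite_eq' Finset.univ a,
      if_pos (Finset.mem_univ _), add_assoc]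
  · rw [Function.update_of_ne hj]
    show x j + ∑ a', Function.update y (i, a) s (j, a') • v a' = x j + ∑ a', y (j, a') • v a'
    refine congrArg (x j + ·) (Finset.sum_congr rfl fun a' _ => ?_)
    rw [Function.update_of_ne (fun h => hj (Prod.mk.inj h).1)]

/-- **Stub 2 of line `one-map-one-jet` — nine-mirror analyticity.** Every normalised,
non-degenerate, translation-invariant, scale-covariant (`0 < Δ`) pointwise scaling limit of the
critical `ℤ³` Ising correlators that is continuous off the diagonals is jointly real-analytic at
every good configuration. Proof: by the tree, such a limit is permutation symmetric
(`QuarterTurnLiouville.stub_limitRegularity`), reflection positive in the nine lattice mirrors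
(`NullLaplacianEdgeGaussianity.stub_nineMirrorRP`, from site-mirror RP of `criticalCorr 3`,
FILS 1978) and has the in-plane light cone of every `B₂` pair of mirrors
(`QuarterTurnLiouville.stub_inPlaneLightCone`), whence the Glimm–Jaffe Thm 6.1.3 half-plane
holomorphy of the two-cluster functions of each mirror and, by the Literature one-mirror lemma +
Bernstein's cross theorem (`eventually_exists_disc_extension_pointShift`), holomorphic extendability
of `t ↦ S n (z with z i := z i + t v_a)` to a fixed disc with a fixed bound, uniformly for `z` near
`x`, for each of the `3n` directions "move point `i` along the good mirror normal `v_a`" (good =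
the heights `⟪x j, v_a⟫` are pairwise distinct). These directions form a basis of `(ℝ³)ⁿ` (the
`v_a` are linearly independent), so the local `3n`-fold cross theorem
(`Literature.Analysis.Complex.exists_holomorphic_extension_of_separately_local_fintype`,
Bernstein–Siciak, by induction from the tree's two-strip theorem) and the chart lemma
`Literature.Analysis.Complex.analyticAt_of_holomorphic_chart_fintype` give `AnalyticAt ℝ (S n) x`.
[cite: GlimmJaffe1987, §6.1 Thm. 6.1.3] [cite: JarnickiPflug2011, Ch. 5 (classical cross theorem with estimate)] -/
theorem stub_nineMirrorAnalyticity :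
    ∀ (ρ : ℝ → ℝ) (Δ : ℝ) (S : CorrFamily 3), (∀ δ ∈ Set.Ioc (0:ℝ) 1, 0 < ρ δ) → 0 < Δ →
      HasPointwiseScalingLimit (criticalCorr 3) ρ S →
      (∀ n z, z ∉ NonCoincident 3 n → S n z = 0) → IsNondegenerateTwoPoint S →
      IsTranslationInvariant S → IsScaleCovariant Δ S →
      (∀ n, ContinuousOn (S n) (NonCoincident 3 n)) →
      ∀ n, AnalyticOnNhd ℝ (S n) (GoodConfig n) := by
  intro ρ Δ S hρ _hΔ hlim hnorm hnd htr hsc hcont n x hx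
  -- order 0: a function on a one-point space
  rcases Nat.eq_zero_or_pos n with hn0 | hnpos
  · subst hn0
    have h0 : S 0 = fun _ => S 0 x := funext fun y => congrArg (S 0) (Subsingleton.elim y x)
    rw [h0]
    exact analyticAt_const
  -- the structure of the limit (tree): permutation symmetry, nine-mirror RP, in-plane light cone
  have hreg : QuarterTurnLiouville.LimitRegularity Δ S :=
    QuarterTurnLiouville.stub_limitRegularity ρ Δ S ⟨hρ, hlim, hnorm, hnd, htr, hsc⟩
  have hnine : QuarterTurnLiouville.NineMirrorRP S := fun m hm =>
    NullLaplacianEdgeGaussianity.stub_nineMirrorRP ρ S hρ hlim hnorm htr m hm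
  have hIP : QuarterTurnLiouville.InPlaneLightCone S :=
    QuarterTurnLiouville.stub_inPlaneLightCone Literature.Analysis.Complex.DiamondCross_holds Δ S
      ⟨hreg, hnine⟩
  obtain ⟨-, -, -, -, -, -, hperm, -, -⟩ := hreg
  obtain ⟨hxnc, v, hli, hvm, hinj⟩ := hx
  have hxinj : Function.Injective x := (mem_nonCoincident x).1 hxnc
  -- directional analyticity in each of the `3n` coordinate directions, locally uniformly (tree)
  have hdir : ∀ ia : Fin n × Fin 3, ∃ r > 0, ∃ M : ℝ, ∀ᶠ z in 𝓝 x, ∃ g : ℂ → ℂ,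
      DifferentiableOn ℂ g (ball (0 : ℂ) r) ∧ (∀ w ∈ ball (0 : ℂ) r, ‖g w‖ ≤ M) ∧
      ∀ t : ℝ, |t| < r →
        g t = ((S n (Function.update z ia.1 (z ia.1 + t • v ia.2)) : ℝ) : ℂ) := by
    intro ia
    have hva : v ia.2 ∈ latticeMirrorNormals (Fin 3) := hvm ia.2
    exact eventually_exists_disc_extension_pointShift (ne_zero_of_mem_latticeMirrorNormals hva)
      hperm htr hcont (NullLaplacianEdgeGaussianity.halfPlaneHolomorphy_of_inPlaneLightCone hIP hva)
      hxinj ia.1 (fun j hj h => hj (hinj ia.2 h))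
  choose r hr M hE using hdir
  -- a uniform radius and bound over the finitely many directions
  set k₀ : Fin n × Fin 3 := (⟨0, hnpos⟩, 0) with hk₀
  have hne : (Finset.univ : Finset (Fin n × Fin 3)).Nonempty := ⟨k₀, Finset.mem_univ _⟩
  set r₀ : ℝ := Finset.univ.inf' hne r with hr₀def
  have hr₀ : 0 < r₀ := (Finset.lt_inf'_iff hne).2 fun ia _ => hr ia
  have hr₀le : ∀ ia, r₀ ≤ r ia := fun ia => Finset.inf'_le _ (Finset.mem_univ ia)
  set M₀ : ℝ := Finset.univ.sup' hne M with hM₀def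
  have hM₀ : ∀ ia, M ia ≤ M₀ := fun ia => Finset.le_sup' _ (Finset.mem_univ ia)
  obtain ⟨ε, hε, hball⟩ := Metric.eventually_nhds_iff.1 (Filter.eventually_all.2 hE)
  -- the affine chart `t ↦ (x j + Σ_a t (j, a) • v a)_j` and a cube staying `ε`-close to `x`
  set cfg : (Fin n × Fin 3 → ℝ) → (Fin n → EuclideanSpace ℝ (Fin 3)) :=
    fun t j => x j + ∑ a, t (j, a) • v a with hcfg
  set Kv : ℝ := ∑ a, ‖v a‖ + 1 with hKv
  have hKvpos : 0 < Kv := by positivity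
  set δ : ℝ := ε / (2 * Kv) with hδ
  have hδpos : 0 < δ := by positivity
  have hnear : ∀ t : Fin n × Fin 3 → ℝ, (∀ k, |t k| < δ) → dist (cfg t) x < ε := by
    intro t ht
    refine (dist_pi_lt_iff hε).2 fun j => ?_
    rw [dist_eq_norm, hcfg]
    dsimp only
    rw [add_sub_cancel_left]
    calc ‖∑ a, t (j, a) • v a‖ ≤ ∑ a, ‖t (j, a) • v a‖ := norm_sum_le _ _
      _ = ∑ a, |t (j, a)| * ‖v a‖ := by simp only [norm_smul, Real.norm_eq_abs]
      _ ≤ ∑ a, δ * ‖v a‖ := Finset.sum_le_sum fun a _ =>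
          mul_le_mul_of_nonneg_right (ht _).le (norm_nonneg _)
      _ = δ * ∑ a, ‖v a‖ := by rw [Finset.mul_sum]
      _ < δ * Kv := by rw [hKv]; exact mul_lt_mul_of_pos_left (by linarith) hδpos
      _ = ε / 2 := by rw [hδ]; field_simp
      _ < ε := by linarith
  -- the function of `3n` real variables and its slice data on the cube of side `ℓ`
  set P : (Fin n × Fin 3 → ℝ) → ℂ := fun t => ((S n (cfg t) : ℝ) : ℂ) with hP
  set ℓ : ℝ := min δ r₀ with hℓdef
  have hℓ : 0 < ℓ := lt_min hδpos hr₀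
  have hℓδ : ℓ ≤ δ := min_le_left _ _
  have hℓr : ∀ ia, ℓ ≤ r ia := fun ia => (min_le_right _ _).trans (hr₀le ia)
  have hslices : ∀ (k : Fin n × Fin 3) (y : Fin n × Fin 3 → ℝ), (∀ j, |y j| < ℓ) →
      ∃ g : ℂ → ℂ, DifferentiableOn ℂ g (ball (0 : ℂ) ℓ) ∧ (∀ w ∈ ball (0 : ℂ) ℓ, ‖g w‖ ≤ M₀) ∧
        ∀ s : ℝ, |s| < ℓ → g s = P (Function.update y k s) := by
    intro k y hy
    obtain ⟨i, a⟩ := k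
    set y₀ : Fin n × Fin 3 → ℝ := Function.update y (i, a) 0 with hy₀
    have hy₀c : ∀ j, |y₀ j| < δ := fun j => by
      by_cases hj : j = (i, a)
      · subst hj
        rw [hy₀, Function.update_self, abs_zero]
        exact hδpos
      · rw [hy₀, Function.update_of_ne hj]
        exact (hy j).trans_le hℓδ
    have h0 : y₀ (i, a) = 0 := by rw [hy₀, Function.update_self]
    obtain ⟨g, hgd, hgb, hgr⟩ := hball (hnear y₀ hy₀c) (i, a)
    refine ⟨g, hgd.mono (ball_subset_ball (hℓr (i, a))),
      fun w hw => (hgb w (ball_subset_ball (hℓr (i, a)) hw)).trans (hM₀ (i, a)), fun s hs => ?_⟩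
    have hcu : cfg (Function.update y (i, a) s) =
        Function.update (cfg y₀) i (cfg y₀ i + s • v a) := by
      have h2 := cfg_update x v y₀ i a s
      rw [h0, sub_zero] at h2
      have h3 : Function.update y (i, a) s = Function.update y₀ (i, a) s := by
        rw [hy₀, Function.update_idem]
      rw [h3]
      exact h2
    rw [hgr s (hs.trans_le (hℓr (i, a)))]
    show ((S n (Function.update (cfg y₀) i (cfg y₀ i + s • v a)) : ℝ) : ℂ) = _
    rw [← hcu]
  have hPb : ∀ t : Fin n × Fin 3 → ℝ, (∀ k, |t k| < ℓ) → ‖P t‖ ≤ M₀ := by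
    intro t ht
    obtain ⟨g, -, hgb, hgr⟩ := hslices k₀ t ht
    have h := hgr (t k₀) (ht k₀)
    rw [Function.update_eq_self] at h
    rw [← h]
    exact hgb _ (by rw [mem_ball_zero_iff, Complex.norm_real, Real.norm_eq_abs]; exact ht k₀)
  -- the local cross theorem in `3n` variables
  obtain ⟨rr, hrr, hcross⟩ :=
    exists_holomorphic_extension_of_separately_local_fintype (ι := Fin n × Fin 3) ℓ hℓ
  obtain ⟨G, hGd, -, hGr⟩ := hcross M₀ P hPb hslices
  -- the basis `(i, a) ↦ δ_i ⊗ v a` of the configuration space, and the chart lemma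
  have hcard : Fintype.card (Fin 3) = Module.finrank ℝ (EuclideanSpace ℝ (Fin 3)) := by simp
  set bv := basisOfLinearIndependentOfCardEqFinrank hli hcard with hbv
  have hbva : ∀ a, bv a = v a := fun a => by rw [hbv, coe_basisOfLinearIndependentOfCardEqFinrank]
  set B : Module.Basis (Fin n × Fin 3) ℝ (Fin n → EuclideanSpace ℝ (Fin 3)) :=
    (Pi.basis fun _ : Fin n => bv).reindex (Equiv.sigmaEquivProd (Fin n) (Fin 3)) with hB
  have hBapp : ∀ (ia : Fin n × Fin 3) (j : Fin n), B ia j = if j = ia.1 then v ia.2 else 0 := by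
    intro ia j
    obtain ⟨i, a⟩ := ia
    rw [hB, Module.Basis.reindex_apply]
    simp [Pi.basis_apply, hbva, Pi.single_apply]
  have hcfgB : ∀ t : Fin n × Fin 3 → ℝ, x + ∑ ia, t ia • B ia = cfg t := by
    intro t
    funext j
    rw [Pi.add_apply, Finset.sum_apply, Fintype.sum_prod_type, Finset.sum_comm, hcfg]
    dsimp only
    congr 1
    refine Finset.sum_congr rfl fun a _ => ?_
    simp only [Pi.smul_apply, hBapp, smul_ite, smul_zero, Finset.sum_ite_eq, Finset.mem_univ,
      if_true]
  exact analyticAt_of_holomorphic_chart_fintype B hrr hGd fun t ht => by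
    rw [hGr t ht, hP]
    dsimp only
    rw [hcfgB]

end Summit.CriticalPhenomena.Ising3DConformalLimit.MoebiusLimitExistsOneMapOneJet

end
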